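import Summits.QuantumFields.YangMills.Theses.MarginalTwistOnset
import Summits.QuantumFields.YangMills.Theses.ThermalRuler
import Summits.QuantumFields.YangMills.Theses.FluxBootstrap

/-!
# Line `centreblind_branch` for crux `CentrelessWeakCouplingYangMills` (stmt-QuantumFields-15941) — registered skeleton

Crux-strategist line (unit `cstrat-stmt-QuantumFields-15941-r1`, BC2 REDIRECT of the RESTATED deciding crux of
`route-QuantumFields-MarginalTwistOnset`; the crux is `YangMills` restricted to compact simple Lie groups with trivial
centre).  The line IS the strategist's typed decomposition, carried as a skeleton because the route-level
`route edit --split` is gated to a seat's final cycle: its three stubs are, BY NAME, the three items of route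
`ThermalRuler` that form the centre-blind branch of the infrared-first programme —

* `stub_strongGapSeqAllG  : ThermalRuler.StrongGapSeqAllG`   (stmt-QuantumFields-10417, IR strong mixing along `b_k → ∞`),
* `stub_softeningCentreBlind : ThermalRuler.SofteningCentreBlind` (stmt-QuantumFields-10418, centre-blind softening),
* `stub_continuumFromMixing : ThermalRuler.ContinuumFromMixing`  (stmt-QuantumFields-16115, UV/OS leg given IR input) —

so NOBODY SHOULD STUB-WORK THEM HERE: claim those items (each has its own registered skeleton
`Cruxes/<Decl>/Lines/birth.lean`); a proof of the item closes the stub by `exact`.  The composition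
`CentrelessWeakCouplingYangMills_of` is kernel-checked and sorry-free (its sorry-free stand-alone twin, with the stub
statements inlined as bodies, is `Lines/split_thermal_centreblind.lean`, attached as evidence on the crux item and ready
to be landed verbatim by a prover under `Theorems/`); `CentrelessWeakCouplingYangMills_of'` / `_proof` conclude the item's primary
decl, the definitionally identical shared copy `FluxBootstrap.CentrelessWeakCouplingYangMills`.  Seam: `Z(G) = ⊥` ⇒ the only central element is `1`, which acts
in a faithful `r` by the scalar `1` (`0 < r.N` because a faithful representation of a non-abelian group is not
`0`-dimensional), so every faithful `r` is centre-blind; IR witness `(r, b, m)` from stub 1, softening of every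
admissible rate sequence from stub 2, Clay clause at `(G, r)` from stub 3.

Probes (planner folder `bc/`, `maxHeartbeats 400000`): `stubᵢ → YangMills`, `stubᵢ → crux` by
`first | exact? | simpa | aesop` FAIL 3/3 (and after `intro/unfold`, `exact?` "could not close the goal" 12/12 incl.
the converses `YangMills → stubᵢ`, `crux → stubᵢ`); `YangMills → crux` holds by restriction (the reason for the
RESTATED bin).  No `Disproof.lean` exists for this crux (`ledger crux ls`, 2026-08-17); negatives index: nothing on
these statements.  References: Jaffe–Witten 2000 §4; Chatterjee, CMP 385 (2021) 1007, Def. 2.3 / Thm. 2.4;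
Borgs–Seiler, CMP 91 (1983) 329; Holland–Minkowski–Pepe–Wiese, NPB 668 (2003) 207.
-/

namespace Summit.QuantumFields.YangMills.Cruxes.CentrelessWeakCouplingYangMills.CentreblindBranch

open Summit.QuantumFields.YangMills.Theses

/-- Stub 1 = item stmt-QuantumFields-10417 BY NAME (IR input: strong exponential decay along some `b_k → ∞` for some
faithful `r`, every compact simple `G`).  Do not stub-work: prove the item. -/
theorem stub_strongGapSeqAllG : ThermalRuler.StrongGapSeqAllG := by
  sorry

/-- Stub 2 = item stmt-QuantumFields-10418 BY NAME (softening of every admissible strong rate sequence for centre-blind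
faithful `r`).  Do not stub-work: prove the item. -/
theorem stub_softeningCentreBlind : ThermalRuler.SofteningCentreBlind := by
  sorry

/-- Stub 3 = item stmt-QuantumFields-16115 BY NAME (UV/OS leg: strong decay + softening along `b` ⇒ the re-typed Clay
clause at `(G, r)`).  Do not stub-work: prove the item. -/
theorem stub_continuumFromMixing : ThermalRuler.ContinuumFromMixing := by
  sorry

/-- A faithful matrix representation of a compact simple (hence non-abelian) group has positive degree. -/
theorem latticeRep_N_pos {G : Type} [Group G] [TopologicalSpace G] [CompactSpace G]
    (hG : Literature.MathematicalPhysics.QuantumFieldTheory.IsCompactSimpleLieGroup G)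
    (r : Literature.MathematicalPhysics.QuantumFieldTheory.LatticeRep G) : 0 < r.N := by
  rcases Nat.eq_zero_or_pos r.N with h | h
  · exfalso
    obtain ⟨a, b, hab⟩ := hG.1.2.1
    haveI : IsEmpty (Fin r.N) := by rw [h]; infer_instance
    exact hab (r.injective (Subsingleton.elim _ _))
  · exact h

/-- In a group with trivial centre no central element acts, in a faithful representation of positive degree, by a
scalar different from `1`. -/
theorem not_exists_central_scalar {G : Type} [Group G] [TopologicalSpace G] [CompactSpace G]
    (hG : Literature.MathematicalPhysics.QuantumFieldTheory.IsCompactSimpleLieGroup G)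
    (hc : Subgroup.center G = ⊥) (r : Literature.MathematicalPhysics.QuantumFieldTheory.LatticeRep G) :
    ¬ ∃ (z : G) (ω : ℂ), (∀ g : G, z * g = g * z) ∧ ω ≠ 1 ∧
      r.ρ z = ω • (1 : Matrix (Fin r.N) (Fin r.N) ℂ) := by
  rintro ⟨z, ω, hz, hω, hρz⟩
  have hz1 : z = 1 := by
    have hmem : z ∈ Subgroup.center G := Subgroup.mem_center_iff.2 fun g => (hz g).symm
    rw [hc] at hmem
    exact Subgroup.mem_bot.1 hmem
  subst hz1
  rw [map_one] at hρz
  have hN : 0 < r.N := latticeRep_N_pos hG r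
  have h00 := congr_fun (congr_fun hρz ⟨0, hN⟩) ⟨0, hN⟩
  simp [Matrix.one_apply_eq, Matrix.smul_apply] at h00
  exact hω h00.symm

/-- **Composition** (kernel-checked, sorry-free): the three stub statements imply the crux BY NAME. -/
theorem CentrelessWeakCouplingYangMills_of :
    ThermalRuler.StrongGapSeqAllG → ThermalRuler.SofteningCentreBlind → ThermalRuler.ContinuumFromMixing →
      MarginalTwistOnset.CentrelessWeakCouplingYangMills := by
  intro hSG hSCB hC G _ _ _ _ hG hc
  obtain ⟨r, b, m, hb, hval⟩ := hSG G hG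
  have hblind := not_exists_central_scalar hG hc r
  exact ⟨r, hC G hG r b hb ⟨m, hval⟩ fun m' hm' => hSCB G hG r hblind b m' hb hm'⟩

/-- The crux from the stubs (sorries only inside `stub_*`), route `MarginalTwistOnset`'s decl. -/
theorem CentrelessWeakCouplingYangMills_holds : MarginalTwistOnset.CentrelessWeakCouplingYangMills :=
  CentrelessWeakCouplingYangMills_of stub_strongGapSeqAllG stub_softeningCentreBlind stub_continuumFromMixing

/-- The same composition concluding the item's PRIMARY decl (the shared copy in route `FluxBootstrap`, definitionally the
same body — this is the form `ledger skeleton check` registers). -/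
theorem CentrelessWeakCouplingYangMills_of' :
    ThermalRuler.StrongGapSeqAllG → ThermalRuler.SofteningCentreBlind → ThermalRuler.ContinuumFromMixing →
      FluxBootstrap.CentrelessWeakCouplingYangMills :=
  CentrelessWeakCouplingYangMills_of

/-- Registered form: the crux (primary decl `FluxBootstrap.CentrelessWeakCouplingYangMills`) from the three stubs. -/
theorem CentrelessWeakCouplingYangMills_proof : FluxBootstrap.CentrelessWeakCouplingYangMills :=
  CentrelessWeakCouplingYangMills_of' stub_strongGapSeqAllG stub_softeningCentreBlind stub_continuumFromMixing

end Summit.QuantumFields.YangMills.Cruxes.CentrelessWeakCouplingYangMills.CentreblindBranch
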